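import Mathlib
import HarnessLib
import Summits.AtomisticToContinuum.Crystallization.Theorems.PricedLinkCensusSoftFourRingsExtraEdge

/-!
# Soft four-rings: a three-fan vertex lies on a slack facet

Support file for `SoftFourRings` (route `PricedLinkCensus`, sub-problem `Crystallization`).

The bond graph enters through an abstract relation `bond` on points (bonds are close pairs,
`⟪y, y'⟫ ≥ 1 − 1.01²/2`; the bonds at the fan centre `v` are exactly `w 0, …, w 3`).  A facet is
*slack* if it is not a triangle, or is a triangle with at least two non-bond sides.

* `exists_side_of_mem_tightSet` — a vertex of a facet is an endpoint of one of its sides;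
* `bond_triangle_eq_of_side` — a facet containing the bond side `{v, w k}` of a three-fan with
  `k = 1, 2` is one of the two bond triangles through it;
* `exists_slack_facet_of_three_fan_one_percent` — **CLAIM B** of the classification: a three-fan
  vertex `v` has a non-bond hull edge `{v, y}` lying in a slack facet (conditional on Tammes-13).
-/

namespace Summit.AtomisticToContinuum.Crystallization.Theorems

open Real RealInnerProductSpace Literature.Geometry.DiscreteGeometry

/-- **A vertex of a facet is an endpoint of a side**: if `v` is tight for the facet normal `c`,
some hull edge `{v, z} ⊆ tightSet X c` starts at `v`. -/
theorem exists_side_of_mem_tightSet {X : Finset (EuclideanSpace ℝ (Fin 3))}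
    (hX1 : ∀ y ∈ X, ‖y‖ = 1) {c : EuclideanSpace ℝ (Fin 3)} (hcF : c ∈ facetNormals X)
    {v : EuclideanSpace ℝ (Fin 3)} (hv : v ∈ tightSet X c) :
    ∃ z ∈ tightSet X c, z ≠ v ∧
      ({v, z} : Finset (EuclideanSpace ℝ (Fin 3))) ∈ hullEdges X := by
  classical
  have hc := ne_zero_of_mem_facetNormals hX1 hcF
  have hm3 : 3 ≤ (facetAngles X c hc).card := by
    rw [card_facetAngles hX1 hc]; exact three_le_card_tightSet hcF
  obtain ⟨j, hj, hjv⟩ := exists_facetVertex_eq hX1 hc hv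
  have hj1 : (j + 1) % (facetAngles X c hc).card < (facetAngles X c hc).card :=
    Nat.mod_lt _ (by omega)
  refine ⟨facetVertex X c hc ((j + 1) % (facetAngles X c hc).card), facetVertex_mem hc hj1, ?_, ?_⟩
  · intro h
    rw [← hjv] at h
    exact succ_mod_ne (by omega) hj
      (facetVertex_injOn hc (Finset.mem_coe.2 (Finset.mem_range.2 hj1))
        (Finset.mem_coe.2 (Finset.mem_range.2 hj)) h)
  · have h' := pair_mem_hullEdges_of_consecutive hX1 hcF hj
    rw [hjv] at h'
    exact h'

/-- Membership in a three-element `Finset`. -/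
theorem mem_three {a b d x : EuclideanSpace ℝ (Fin 3)} :
    x ∈ ({a, b, d} : Finset (EuclideanSpace ℝ (Fin 3))) ↔ x = a ∨ x = b ∨ x = d := by
  rw [Finset.mem_insert, Finset.mem_insert, Finset.mem_singleton]

/-- A pair is contained in a triple listing both of its elements (first and second). -/
theorem pair_subset_three_left (a b d : EuclideanSpace ℝ (Fin 3)) :
    ({a, b} : Finset (EuclideanSpace ℝ (Fin 3))) ⊆ {a, b, d} := by
  intro x hx
  rw [Finset.mem_insert, Finset.mem_singleton] at hx
  rw [mem_three]
  rcases hx with rfl | rfl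
  exacts [Or.inl rfl, Or.inr (Or.inl rfl)]

/-- A pair is contained in a triple listing both of its elements (first and third). -/
theorem pair_subset_three_right (a b d : EuclideanSpace ℝ (Fin 3)) :
    ({a, d} : Finset (EuclideanSpace ℝ (Fin 3))) ⊆ {a, b, d} := by
  intro x hx
  rw [Finset.mem_insert, Finset.mem_singleton] at hx
  rw [mem_three]
  rcases hx with rfl | rfl
  exacts [Or.inl rfl, Or.inr (Or.inr rfl)]

/-- **The facets through an inner bond of a three-fan are the two bond triangles.**  With the
bond-triangle facets `c₀ ⊇ {v, w 0, w 1}`, `c₁ ⊇ {v, w 1, w 2}`, `c₂ ⊇ {v, w 2, w 3}`: a facet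
whose tight set contains `v` and `w 1` is `c₀` or `c₁`, and one containing `v` and `w 2` is `c₁`
or `c₂`. -/
theorem bond_triangle_eq_of_side {X : Finset (EuclideanSpace ℝ (Fin 3))}
    (hX1 : ∀ y ∈ X, ‖y‖ = 1)
    (h0 : (0 : EuclideanSpace ℝ (Fin 3)) ∈ interior (convexHull ℝ (X : Set (EuclideanSpace ℝ (Fin 3)))))
    {v a b d : EuclideanSpace ℝ (Fin 3)} (hvb : ({v, b} : Finset (EuclideanSpace ℝ (Fin 3))) ∈ hullEdges X)
    {cL cR c : EuclideanSpace ℝ (Fin 3)} (hcL : cL ∈ facetNormals X) (hcR : cR ∈ facetNormals X)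
    (hc : c ∈ facetNormals X) (hLR : cL ≠ cR)
    (hTL : tightSet X cL = {v, a, b}) (hTR : tightSet X cR = {v, b, d})
    (hvc : v ∈ tightSet X c) (hbc : b ∈ tightSet X c) : c = cL ∨ c = cR := by
  classical
  by_contra h
  push Not at h
  refine false_of_three_facetsOfEdge hX1 h0 hvb hcL hcR hc ?_ ?_ ?_ hLR (Ne.symm h.1) (Ne.symm h.2)
  · rw [hTL]; exact pair_subset_three_right v a b
  · rw [hTR]; exact pair_subset_three_left v b d
  · intro x hx
    rw [Finset.mem_insert, Finset.mem_singleton] at hx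
    rcases hx with rfl | rfl
    exacts [hvc, hbc]

/-- **CLAIM B: a three-fan vertex lies on a slack facet** (conditional on Tammes-13).
Setting: `≥ 12` unit vectors `X`, pairwise `⟪·,·⟫ ≤ 1 − 1/(2·1.01²)`; an abstract bond
relation refining closeness (`bond y y' → ⟪y, y'⟫ ≥ 1 − 1.01²/2`); `v ∈ X` whose bonds inside `X`
are exactly `w 0, …, w 3`, with `w 0 ∼ w 1 ∼ w 2 ∼ w 3` bonded (three bond triangles at `v`).
Conclusion: there are a non-bond hull edge `{v, y}` and a facet `c ∋ v, y` which is *slack*: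
either its tight set is not a triangle, or it is a triangle `{v, y, z}` with a second non-bond
side (`¬ bond v z ∨ ¬ bond y z`).  Proof: by rule R1 there is a hull edge `{v, y}` leaving the
fan; if both facets through it were triangles `{v, y, z}` with `v z`, `y z` bonds, then `z` is a
bond of `v`, i.e. some `w k`; `k = 1, 2` is excluded because the facets through `{v, w k}` are
bond triangles, and the two remaining facets give `z = w 0` and `z = w 3`, so `y` is bonded to
both ends of the fan — excluded by `no_three_triangles_quad`. -/
theorem exists_slack_facet_of_three_fan_one_percent (hT : musinTarasov2012_tammes_thirteen)
    {X : Finset (EuclideanSpace ℝ (Fin 3))} (hX1 : ∀ y ∈ X, ‖y‖ = 1) (hcard : 12 ≤ X.card)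
    (hsepX : ∀ u ∈ X, ∀ u' ∈ X, u ≠ u' → ⟪u, u'⟫ ≤ 1 - 1 / (2 * (101 / 100 : ℝ) ^ 2))
    (bond : EuclideanSpace ℝ (Fin 3) → EuclideanSpace ℝ (Fin 3) → Prop)
    (hbclose : ∀ y y', bond y y' → 1 - (101 / 100 : ℝ) ^ 2 / 2 ≤ ⟪y, y'⟫)
    {v : EuclideanSpace ℝ (Fin 3)} (hv : v ∈ X) (w : Fin 4 → EuclideanSpace ℝ (Fin 3))
    (hwX : ∀ k, w k ∈ X) (hwinj : Function.Injective w) (hwv : ∀ k, w k ≠ v)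
    (hvw : ∀ k, bond v (w k)) (hvonly : ∀ y ∈ X, bond v y → ∃ k, y = w k)
    (h01 : bond (w 0) (w 1)) (h12 : bond (w 1) (w 2)) (h23 : bond (w 2) (w 3)) :
    ∃ y ∈ X, ∃ c ∈ facetNormals X, y ≠ v ∧ ¬ bond v y ∧
      ({v, y} : Finset (EuclideanSpace ℝ (Fin 3))) ∈ hullEdges X ∧
      v ∈ tightSet X c ∧ y ∈ tightSet X c ∧
      ((tightSet X c).card ≠ 3 ∨
        ∃ z, tightSet X c = {v, y, z} ∧ (¬ bond v z ∨ ¬ bond y z)) := by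
  classical
  have h0 : (0 : EuclideanSpace ℝ (Fin 3)) ∈ interior (convexHull ℝ (X : Set (EuclideanSpace ℝ (Fin 3)))) :=
    zero_mem_interior_convexHull_of_twelve_le_card hT hX1 hcard
      (ca := 1 - 1 / (2 * (101 / 100 : ℝ) ^ 2)) (by norm_num) hsepX
  have hvw' : ∀ k, 1 - (101 / 100 : ℝ) ^ 2 / 2 ≤ ⟪v, w k⟫ := fun k => hbclose _ _ (hvw k)
  have hw01 : w 0 ≠ w 1 := fun h => by simpa using hwinj h
  have hw12 : w 1 ≠ w 2 := fun h => by simpa using hwinj h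
  have hw23 : w 2 ≠ w 3 := fun h => by simpa using hwinj h
  have hw02 : w 0 ≠ w 2 := fun h => by simpa using hwinj h
  have hw13 : w 1 ≠ w 3 := fun h => by simpa using hwinj h
  have hw03 : w 0 ≠ w 3 := fun h => by simpa using hwinj h
  -- the three bond-triangle facets
  obtain ⟨c₀, hc₀F, hc₀T, -, -⟩ := bond_triangle_facet_one_percent hX1 hsepX hv (hwX 0) (hwX 1)
    (hwv 0).symm (hwv 1).symm hw01 (hvw' 0) (hvw' 1) (hbclose _ _ h01)
  obtain ⟨c₁, hc₁F, hc₁T, -, -⟩ := bond_triangle_facet_one_percent hX1 hsepX hv (hwX 1) (hwX 2)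
    (hwv 1).symm (hwv 2).symm hw12 (hvw' 1) (hvw' 2) (hbclose _ _ h12)
  obtain ⟨c₂, hc₂F, hc₂T, -, -⟩ := bond_triangle_facet_one_percent hX1 hsepX hv (hwX 2) (hwX 3)
    (hwv 2).symm (hwv 3).symm hw23 (hvw' 2) (hvw' 3) (hbclose _ _ h23)
  have hc01 : c₀ ≠ c₁ := by
    intro h
    have : w 0 ∈ tightSet X c₁ := by rw [← h, hc₀T, mem_three]; exact Or.inr (Or.inl rfl)
    rw [hc₁T, mem_three] at this
    rcases this with h | h | h
    exacts [hwv 0 h, hw01 h, hw02 h]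
  have hc12 : c₁ ≠ c₂ := by
    intro h
    have : w 1 ∈ tightSet X c₂ := by rw [← h, hc₁T, mem_three]; exact Or.inr (Or.inl rfl)
    rw [hc₂T, mem_three] at this
    rcases this with h | h | h
    exacts [hwv 1 h, hw12 h, hw13 h]
  -- rule R1: a hull edge `{v, y}` leaving the fan
  obtain ⟨y, hyX, hyv, hyw, hEy⟩ := exists_extra_hullEdge_of_three_fan_one_percent hT hX1 hcard
    hsepX hv w hwX hwinj hwv hvw' (hbclose _ _ h01) (hbclose _ _ h12) (hbclose _ _ h23)
  have hnb : ¬ bond v y := fun h => by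
    obtain ⟨k, rfl⟩ := hvonly y hyX h
    exact hyw k rfl
  -- the two facets through `{v, y}`
  obtain ⟨c', hc'F, -, hc'T⟩ := exists_facet_ne_of_mem_hullEdges hX1 h0 hEy 0
  obtain ⟨c'', hc''F, hc''c', hc''T⟩ := exists_facet_ne_of_mem_hullEdges hX1 h0 hEy c'
  have hvc' : v ∈ tightSet X c' := hc'T (Finset.mem_insert_self _ _)
  have hyc' : y ∈ tightSet X c' := hc'T (Finset.mem_insert_of_mem (Finset.mem_singleton_self _))
  have hvc'' : v ∈ tightSet X c'' := hc''T (Finset.mem_insert_self _ _)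
  have hyc'' : y ∈ tightSet X c'' :=
    hc''T (Finset.mem_insert_of_mem (Finset.mem_singleton_self _))
  -- if either facet is slack we are done
  by_cases hs' : (tightSet X c').card ≠ 3 ∨
      ∃ z, tightSet X c' = {v, y, z} ∧ (¬ bond v z ∨ ¬ bond y z)
  · exact ⟨y, hyX, c', hc'F, hyv, hnb, hEy, hvc', hyc', hs'⟩
  by_cases hs'' : (tightSet X c'').card ≠ 3 ∨
      ∃ z, tightSet X c'' = {v, y, z} ∧ (¬ bond v z ∨ ¬ bond y z)
  · exact ⟨y, hyX, c'', hc''F, hyv, hnb, hEy, hvc'', hyc'', hs''⟩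
  exfalso
  push Not at hs' hs''
  -- both are triangles `{v, y, z}` with `v z`, `y z` bonds
  have third : ∀ {c : EuclideanSpace ℝ (Fin 3)}, v ∈ tightSet X c → y ∈ tightSet X c →
      (tightSet X c).card = 3 → ∃ z, tightSet X c = {v, y, z} := by
    intro c hvc hyc h3
    have hns : ¬ (tightSet X c ⊆ {v, y}) := fun h => by
      have := Finset.card_le_card h
      rw [h3, Finset.card_pair hyv.symm] at this
      omega
    obtain ⟨z, hzc, hz⟩ := Finset.not_subset.1 hns
    rw [Finset.mem_insert, Finset.mem_singleton, not_or] at hz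
    refine ⟨z, ?_⟩
    symm
    apply Finset.eq_of_subset_of_card_le
    · intro x hx
      rw [mem_three] at hx
      rcases hx with rfl | rfl | rfl
      exacts [hvc, hyc, hzc]
    · rw [h3, Finset.card_eq_three.2 ⟨v, y, z, hyv.symm, fun h => hz.1 h.symm,
        fun h => hz.2 h.symm, rfl⟩]
  obtain ⟨z', hz'⟩ := third hvc' hyc' hs'.1
  obtain ⟨z'', hz''⟩ := third hvc'' hyc'' hs''.1
  obtain ⟨hvz', hyz'⟩ := hs'.2 z' hz'
  obtain ⟨hvz'', hyz''⟩ := hs''.2 z'' hz''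
  have hz'X : z' ∈ X := tightSet_subset X c' (by rw [hz', mem_three]; exact Or.inr (Or.inr rfl))
  have hz''X : z'' ∈ X := tightSet_subset X c'' (by rw [hz'', mem_three]; exact Or.inr (Or.inr rfl))
  obtain ⟨k', hk'⟩ := hvonly z' hz'X hvz'
  obtain ⟨k'', hk''⟩ := hvonly z'' hz''X hvz''
  -- `z' ≠ z''` (distinct facets have distinct tight sets)
  have hzz : z' ≠ z'' := by
    intro h
    apply hc''c'
    refine ((mem_facetNormals.1 hc''F).eq_of_tightSet_eq ?_)
    rw [hz'', hz', h]
  -- neither is `w 1` or `w 2`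
  have hmid : ∀ {c : EuclideanSpace ℝ (Fin 3)} {z : EuclideanSpace ℝ (Fin 3)}, c ∈ facetNormals X →
      tightSet X c = {v, y, z} → z ≠ w 1 ∧ z ≠ w 2 := by
    intro c z hcF hz
    have hvc : v ∈ tightSet X c := by rw [hz, mem_three]; exact Or.inl rfl
    have hzc : z ∈ tightSet X c := by rw [hz, mem_three]; exact Or.inr (Or.inr rfl)
    have hyc : y ∈ tightSet X c := by rw [hz, mem_three]; exact Or.inr (Or.inl rfl)
    constructor
    · intro h
      rw [h] at hzc
      have hE1 : ({v, w 1} : Finset (EuclideanSpace ℝ (Fin 3))) ∈ hullEdges X :=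
        pair_mem_hullEdges_of_soft_bond_one_percent hX1 hsepX hv (hwX 1) (hwv 1).symm (hvw' 1)
      rcases bond_triangle_eq_of_side hX1 h0 hE1 hc₀F hc₁F hcF hc01 hc₀T hc₁T hvc hzc with rfl | rfl
      · rw [hc₀T, mem_three] at hyc
        rcases hyc with h | h | h
        exacts [hyv h, hyw 0 h, hyw 1 h]
      · rw [hc₁T, mem_three] at hyc
        rcases hyc with h | h | h
        exacts [hyv h, hyw 1 h, hyw 2 h]
    · intro h
      rw [h] at hzc
      have hE2 : ({v, w 2} : Finset (EuclideanSpace ℝ (Fin 3))) ∈ hullEdges X :=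
        pair_mem_hullEdges_of_soft_bond_one_percent hX1 hsepX hv (hwX 2) (hwv 2).symm (hvw' 2)
      rcases bond_triangle_eq_of_side hX1 h0 hE2 hc₁F hc₂F hcF hc12 hc₁T hc₂T hvc hzc with rfl | rfl
      · rw [hc₁T, mem_three] at hyc
        rcases hyc with h | h | h
        exacts [hyv h, hyw 1 h, hyw 2 h]
      · rw [hc₂T, mem_three] at hyc
        rcases hyc with h | h | h
        exacts [hyv h, hyw 2 h, hyw 3 h]
  obtain ⟨h1', h2'⟩ := hmid hc'F hz'
  obtain ⟨h1'', h2''⟩ := hmid hc''F hz''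
  -- so `{z', z''} = {w 0, w 3}` and `y` is bonded to both ends of the fan
  have hends : (bond y (w 0)) ∧ (bond y (w 3)) := by
    subst hk' hk''
    fin_cases k' <;> fin_cases k''
    all_goals first
      | exact absurd rfl hzz
      | exact absurd rfl h1'
      | exact absurd rfl h2'
      | exact absurd rfl h1''
      | exact absurd rfl h2''
      | exact ⟨hyz', hyz''⟩
      | exact ⟨hyz'', hyz'⟩
  have hsep : ∀ i j, i ≠ j → ⟪w i, w j⟫ ≤ 1 - 1 / (2 * (101 / 100 : ℝ) ^ 2) :=
    fun i j hij => hsepX (w i) (hwX i) (w j) (hwX j) (fun h => hij (hwinj h))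
  refine no_three_triangles_quad_one_percent (hX1 v hv) w (fun k => hX1 _ (hwX k)) y (hX1 y hyX)
    (fun k => ⟨hvw' k, hsepX v hv (w k) (hwX k) (hwv k).symm⟩) hsep (hbclose _ _ h01)
    (hbclose _ _ h12) (hbclose _ _ h23) (hsepX v hv y hyX hyv.symm) ?_ ?_
  · rw [real_inner_comm]; exact hbclose _ _ hends.1
  · rw [real_inner_comm]; exact hbclose _ _ hends.2

end Summit.AtomisticToContinuum.Crystallization.Theorems
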